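import Summits.AtomisticToContinuum.Crystallization.Theorems.TwoCentreKissingKernelRobustTangencyBoundCvxSystem
import Mathlib.Tactic.IntervalCases
import HarnessLib

/-!
# `RobustTangencyBound` — kernel certificates (A) of configuration `Pv21` (step (III) factory)

Route `TwoCentreKissingKernel`, item `stmt-AtomisticToContinuum-12082`, blueprint (III) §11.  Generated by `work/factory/factory.py` from the spec
`Pv21`: 5 points, soft sides [(1, 2), (2, 3), (3, 4), (4, 5), (1, 5)], diagonals [(1, 3), (1, 4)],
facets [(1, 2, 3), (1, 3, 4), (1, 4, 5)], constrained vertices [(2, [(1, 2, 3)])].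
Variables: diagonals, sides (spec order), then the regular blocks; precision 2^-14, 5 Heron steps.
-/

namespace Summit.AtomisticToContinuum.Crystallization.Theorems

open Literature.Analysis.ValidatedNumerics

/-- Corner of facet `{p₁,p₂,p₃}` at `p₂` (between `p₁`, `p₃`), forward form. -/
def pv21K2f123 : RExpr × RExpr :=
  cornerR (.sub (.var 0) (.mul (.var 2) (.var 3)))
    (.mul (.sub (.const 1) (.sq (.var 2))) (.sub (.const 1) (.sq (.var 3))))

/-- The cluster corner factors at the constrained vertices `p₂` (block order). -/
def pv21Facs : List (List (RExpr × RExpr)) := [[pv21K2f123]]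

/-- The box: diagonals, soft sides, then the regular `(C, S)` windows. -/
def pv21Box (m1 : ℕ) : Box :=
  [(((-51 : ℚ)) / 100, (502 : ℚ) / 1000), (((-51 : ℚ)) / 100, (502 : ℚ) / 1000), ((497 : ℚ) / 1000, (502 : ℚ) / 1000), ((497 : ℚ) / 1000, (502 : ℚ) / 1000), ((497 : ℚ) / 1000, (502 : ℚ) / 1000), ((497 : ℚ) / 1000, (502 : ℚ) / 1000), ((497 : ℚ) / 1000, (502 : ℚ) / 1000), (((-51 : ℚ)) / 100, (502 : ℚ) / 1000), (((-51 : ℚ)) / 100, (502 : ℚ) / 1000)] ++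
    (List.replicate (m1) [((3252 : ℚ) / 10000, (3415 : ℚ) / 10000),
      ((9398 : ℚ) / 10000, (9457 : ℚ) / 10000)]).flatten

/-- The convexity constraints `g ≥ 0` of configuration `Pv21` (one per long internal edge and side). -/
def pv21Gs : List RExpr := [cvxR 0 2 3 1 4 7, cvxR 0 1 4 2 3 7, cvxR 1 0 4 6 5 8, cvxR 1 6 5 0 4 8]

/-- The infeasibility claim of configuration `Pv21`. -/
def pv21Claim (m1 : ℕ) : RInfeasClaim :=
  ⟨pv21Gs, clusterHs pv21Facs [m1] 9, pv21Box m1⟩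

/-- The regular-corner counts NOT excluded at this level (handled with more constrained vertices). -/
def pv21Bad : List (ℕ) :=
  [(3), (4)]

/-- Kernel certificate of `pv21Claim 0`. -/
theorem pv21Claim_holds_0 : (pv21Claim 0).Holds :=
  RInfeasClaim.holds_of_check _ (.leaf (14, 5)) (by decide +kernel)

/-- Kernel certificate of `pv21Claim 1`. -/
theorem pv21Claim_holds_1 : (pv21Claim 1).Holds :=
  RInfeasClaim.holds_of_check _ (.leaf (14, 5)) (by decide +kernel)

/-- Kernel certificate of `pv21Claim 2`. -/
theorem pv21Claim_holds_2 : (pv21Claim 2).Holds :=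
  RInfeasClaim.holds_of_check _ (.leaf (14, 5)) (by decide +kernel)

/-- Kernel certificate of `pv21Claim 5`. -/
theorem pv21Claim_holds_5 : (pv21Claim 5).Holds :=
  RInfeasClaim.holds_of_check _ (.leaf (14, 5)) (by decide +kernel)

/-- **Configuration `Pv21` is infeasible (kernel certificates)**, all `m ≤ 5`. -/
theorem pv21Claim_holds (m1 : ℕ) (hm1 : m1 ≤ 5)
    (hgood : ((m1) : ℕ) ∉ pv21Bad) :
    (pv21Claim m1).Holds := by
  interval_cases m1
  · exact pv21Claim_holds_0
  · exact pv21Claim_holds_1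
  · exact pv21Claim_holds_2
  · exact (hgood (by decide)).elim
  · exact (hgood (by decide)).elim
  · exact pv21Claim_holds_5

end Summit.AtomisticToContinuum.Crystallization.Theorems
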